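import Summits.FinalStateConjecture.FinalStateConjecture.Theorems.PhotonSphereChannelsEndVisibleDefs
import Summits.FinalStateConjecture.FinalStateConjecture.Theorems.ChannelsResolveTameDevelopmentsR.Negative.MinkowskiEndVisible
import Literature.Geometry.Lorentzian.CompleteDevelopmentMaximal
import Literature.Geometry.Lorentzian.IsometricImmersionExp
import Literature.Geometry.Lorentzian.CauchyDevelopmentOneJet
import Literature.Geometry.Lorentzian.CauchyDevelopmentIsometryClasses
import Literature.Geometry.Lorentzian.RelativeDevelopmentGluingCauchy
import Literature.Geometry.Lorentzian.ConvergenceTransport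
import Literature.Geometry.Lorentzian.LeviCivitaProofs
import HarnessLib

/-!
# End-visibility is an invariant of the isometry class of a Cauchy development — route
# PhotonSphereChannels, crux `ChannelsResolveTameDevelopmentsR` (K2R-T2, stmt-FinalStateConjecture-17430),
# line `Sketch`: transport of the NoHidden vocabulary along isometries of developments

Maximal vacuum Cauchy developments are unique only up to isometry of developments
(`CauchyDevelopment.IsIsometricTo`: a time-orientation preserving isometry `ψ : M₁ ≃ M₂` with
`ψ ∘ ι₁ = ι₂`; Choquet-Bruhat–Geroch 1969, Sbierski 2016), and the two registered stubs of line
`Sketch` quantify over ALL maximal developments of a datum. This file checks that the vocabulary of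
the split (`Theorems/PhotonSphereChannelsEndVisibleDefs`) is invariant under such isometries, so that a
certificate at ONE maximal development of a datum is a certificate on the whole fibre:

* `isNormalisedNullRayFrom_comp` — a time-orientation preserving isometric immersion `φ` with an
  isometric-immersion left inverse `φ'` and `φ ∘ ι₁ = ι₂` carries normalised future null rays from `p`
  to normalised future null rays from `p` (geodesics to geodesics, `IsIsometricImmersion.isGeodesicOn_comp`,
  O'Neill 1983, pp. 90–91; maximality by pulling an extension back along `φ'`; null / future-directed by
  `g₂(dφ u, dφ w) = g₁(u, w)` and the timecone lemma; the normalisation because `dφ ν₁ = ν₂`,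
  `DataEmbedding.mfderiv_normal`, Sbierski 2016, §3.1);
* `mem_chronologicalFuture_comp`, `mem_chronologicalPast_comp` — `φ` carries `I^±` into `I^±`
  (timelike curves to timelike curves, `IsFutureTimelikeCurveOn.comp_isIsometricImmersion`);
* `IsEndVisibleEvent.comp`, `image_endVisibleRegion_subset` — hence end-visible events to end-visible
  events (same `X`, same compact `K`, same launch point);
* `symm_package` — the inverse of an isometry of developments is one (the data needed above for
  `ψ.symm`, as in `DataEmbedding.IsIsometricTo.symm`);
* `completeRaysNearEndVisible_of_isIsometricTo`, `completeRaysNearEndVisible_iff_of_isIsometricTo` —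
  **NoHidden per development (`CompleteRaysNearEndVisible`) descends to isometry classes.**

Consequence (§4): with NoHidden at the model point (`MinkowskiModel.minkowski_completeRaysNearEndVisible`,
`Negative/MinkowskiEndVisible`) and the UNCONDITIONAL identification of every maximal development of the
trivial datum with Minkowski space up to isometry of developments
(`Minkowski.isIsometricTo_vacuumCauchyDevelopment_of_isMaximal`, `CompleteDevelopmentMaximal.lean`),
**the registered stub `stub_noHiddenCompleteRays` HOLDS ON THE WHOLE FIBRE `(X, D) = (ℝ³, (δ, 0))`**
(`stub_noHiddenCompleteRays_trivialData`) — here `IsMaximal` is used, not idle. All results proved;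
no named facts.

## References

* B. O'Neill, *Semi-Riemannian geometry* (1983), Ch. 3, pp. 58, 90–91 (isometries, geodesics);
  Ch. 5, p. 145 (timecones); Ch. 14, p. 402.
* J. Sbierski, Ann. Henri Poincaré 17 (2016) 301–329, §2 (isometry classes of GHDs), §3.1.
* Y. Choquet-Bruhat, R. Geroch, Comm. Math. Phys. 14 (1969) 329–335, Thm. 3.
* S. W. Hawking, G. F. R. Ellis (1973), §9.2.
-/

noncomputable section

-- the problem namespace `Summit.FinalStateConjecture.FinalStateConjecture` repeats a segment by design (D-0022)
set_option linter.dupNamespace false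

open Set Function Filter TopologicalSpace Topology
open scoped Manifold ContDiff

namespace Summit.FinalStateConjecture.FinalStateConjecture.Theorems.EndVisible

open Literature.Geometry.Lorentzian

variable {X : Type} [TopologicalSpace X] [ChartedSpace E3 X] [IsManifold (𝓡 3) ∞ X]
  [ConnectedSpace X] {D : InitialDataSet (𝓡 3) X} {𝒟₁ 𝒟₂ : CauchyDevelopment D}

/-! ## §1. Transport along a time-orientation preserving isometric immersion with a left inverse -/

section Transport

variable {φ : 𝒟₁.carrier → 𝒟₂.carrier} {φ' : 𝒟₂.carrier → 𝒟₁.carrier}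

/-- `g₂(dφ u, dφ w) = g₁(u, w)` for an isometric immersion of developments (the defining identity,
read pointwise). [cite: ONeillSemiRiemannian1983, Ch. 3, p. 58] -/
theorem val_mfderiv_mfderiv
    (hφ : 𝒟₁.metric.IsIsometricImmersion 𝒟₂.metric.toPseudoRiemannianMetric φ) (y : 𝒟₁.carrier)
    (u w : TangentSpace (𝓡 (3 + 1)) y) :
    𝒟₂.metric.val (φ y) (mfderiv (𝓡 (3 + 1)) (𝓡 (3 + 1)) φ y u) (mfderiv (𝓡 (3 + 1)) (𝓡 (3 + 1)) φ y w) =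
      𝒟₁.metric.val y u w := by
  have h := congrArg (fun b ↦ b u w) (hφ.2 y)
  simpa only [pullbackBilin_apply] using h

/-- **Isometries of developments carry normalised null rays to normalised null rays.** Let
`φ : M₁ → M₂` be a time-orientation preserving isometric immersion with `φ ∘ ι₁ = ι₂`, admitting an
isometric immersion `φ' : M₂ → M₁` with `φ' ∘ φ = id`. If `γ` is a normalised future null ray of `𝒟₁`
from `p` on `dom`, then `φ ∘ γ` is a normalised future null ray of `𝒟₂` from `p` on `dom`: it is a
geodesic with velocity `dφ(γ')` (`IsIsometricImmersion.isGeodesicOn_comp`), maximal (a geodesic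
extension `γ'` on `s' ⊋ dom` would pull back to the geodesic extension `φ' ∘ γ'` of `γ`), starts at
`φ (ι₁ p) = ι₂ p`, is null and future-directed (`dφ` preserves scalar products, is injective, and maps
the future cone into the future cone), and is normalised: `g₂(dφ γ'(0), ν₂ p) = g₂(dφ γ'(0), dφ ν₁ p)
= g₁(γ'(0), ν₁ p) = −1` (`DataEmbedding.mfderiv_normal`). [cite: ONeillSemiRiemannian1983, Ch. 3, pp. 90–91] -/
theorem isNormalisedNullRayFrom_comp [𝒟₁.metric.HasLeviCivita] [𝒟₂.metric.HasLeviCivita]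
    (hφ : 𝒟₁.metric.IsIsometricImmersion 𝒟₂.metric.toPseudoRiemannianMetric φ)
    (hφ' : 𝒟₂.metric.IsIsometricImmersion 𝒟₁.metric.toPseudoRiemannianMetric φ')
    (hleft : LeftInverse φ' φ)
    (hτ : 𝒟₁.timeOrientation.PreservesTimeOrientation φ 𝒟₂.timeOrientation)
    (hι : φ ∘ 𝒟₁.embed = 𝒟₂.embed)
    {p : X} {γ : ℝ → 𝒟₁.carrier} {dom : Set ℝ}
    (hray : 𝒟₁.metric.IsNormalisedNullRayFrom 𝒟₁.timeOrientation 𝒟₁.embed 𝒟₁.normal p γ dom) :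
    𝒟₂.metric.IsNormalisedNullRayFrom 𝒟₂.timeOrientation 𝒟₂.embed 𝒟₂.normal p (φ ∘ γ) dom := by
  obtain ⟨hmax, h0, hγ0, hnull, hfd, hnorm⟩ := hray
  obtain ⟨hopen, hoc, hgeo, hmaximal⟩ := hmax
  -- geodesics go to geodesics, with velocity `dφ(γ')`
  obtain ⟨hgeo₂, hvel⟩ := hφ.isGeodesicOn_comp rfl hopen hgeo
  have hv : velocity (𝓡 (3 + 1)) (φ ∘ γ) 0 =
      mfderiv (𝓡 (3 + 1)) (𝓡 (3 + 1)) φ (γ 0) (velocity (𝓡 (3 + 1)) γ 0) := hvel 0 h0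
  have hφγ0 : (φ ∘ γ) 0 = 𝒟₂.embed p := by
    show φ (γ 0) = 𝒟₂.embed p
    rw [hγ0]
    exact congrFun hι p
  refine ⟨⟨hopen, hoc, hgeo₂, fun γ' s' hs'o hs'oc hsub hgeo' heq ↦ ?_⟩, h0, hφγ0, ?_, ?_, ?_⟩
  · -- maximality: pull the extension back along `φ'`
    obtain ⟨hgeo₁', -⟩ := hφ'.isGeodesicOn_comp rfl hs'o hgeo'
    refine hmaximal (φ' ∘ γ') s' hs'o hs'oc hsub hgeo₁' fun t ht ↦ ?_
    show γ t = φ' (γ' t)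
    rw [← heq ht]
    exact (hleft (γ t)).symm
  · -- null
    refine ⟨?_, fun hz ↦ hnull.2 (hφ.injective_mfderiv (γ 0) ?_)⟩
    · show 𝒟₂.metric.val (φ (γ 0)) (velocity (𝓡 (3 + 1)) (φ ∘ γ) 0) (velocity (𝓡 (3 + 1)) (φ ∘ γ) 0) = 0
      rw [hv, val_mfderiv_mfderiv hφ]
      exact hnull.1
    · rw [← hv, map_zero]
      exact hz
  · -- future-directed
    show 𝒟₂.timeOrientation.IsFutureDirected (velocity (𝓡 (3 + 1)) (φ ∘ γ) 0)
    rw [hv]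
    exact hτ.isFutureDirected_mfderiv hφ.2 hfd
  · -- normalisation against `ν₂ p = dφ (ν₁ p)`
    have hn := DataEmbedding.mfderiv_normal 𝒟₁.toDataEmbedding 𝒟₂.toDataEmbedding hφ hτ hι p
    show 𝒟₂.metric.val (𝒟₂.embed p) (velocity (𝓡 (3 + 1)) (φ ∘ γ) 0) (𝒟₂.normal p) = -1
    have hpt : 𝒟₂.embed p = φ (𝒟₁.embed p) := (congrFun hι p).symm
    have h1 : 𝒟₂.metric.val (𝒟₂.embed p) (velocity (𝓡 (3 + 1)) (φ ∘ γ) 0) (𝒟₂.normal p) =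
        𝒟₂.metric.val (φ (𝒟₁.embed p))
          (mfderiv (𝓡 (3 + 1)) (𝓡 (3 + 1)) φ (𝒟₁.embed p) (velocity (𝓡 (3 + 1)) γ 0))
          (mfderiv (𝓡 (3 + 1)) (𝓡 (3 + 1)) φ (𝒟₁.embed p) (𝒟₁.normal p)) := by
      rw [hv, hγ0]
      exact congrArg₂ (fun x w ↦ 𝒟₂.metric.val x
        (mfderiv (𝓡 (3 + 1)) (𝓡 (3 + 1)) φ (𝒟₁.embed p) (velocity (𝓡 (3 + 1)) γ 0)) w) hpt
        (by rw [← hn])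
    rw [h1, val_mfderiv_mfderiv hφ]
    have h2 : 𝒟₁.metric.val (𝒟₁.embed p) (velocity (𝓡 (3 + 1)) γ 0) (𝒟₁.normal p) = -1 := hnorm
    exact h2

/-- **Isometric immersions of developments carry chronological futures into chronological futures**
(`q ∈ I⁺(S) ⇒ φ q ∈ I⁺(φ(S))`: future timelike curves go to future timelike curves,
`IsFutureTimelikeCurveOn.comp_isIsometricImmersion`). [cite: ONeillSemiRiemannian1983, Ch. 14, p. 402] -/
theorem mem_chronologicalFuture_comp
    (hφ : 𝒟₁.metric.IsIsometricImmersion 𝒟₂.metric.toPseudoRiemannianMetric φ)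
    (hτ : 𝒟₁.timeOrientation.PreservesTimeOrientation φ 𝒟₂.timeOrientation)
    {S : Set 𝒟₁.carrier} {q : 𝒟₁.carrier} (hq : q ∈ 𝒟₁.metric.chronologicalFuture 𝒟₁.timeOrientation S) :
    φ q ∈ 𝒟₂.metric.chronologicalFuture 𝒟₂.timeOrientation (φ '' S) := by
  obtain ⟨x, hx, c, a, b, hab, hc, hca, hcb⟩ := hq
  have hφd : MDifferentiable (𝓡 (3 + 1)) (𝓡 (3 + 1)) φ := hφ.1.mdifferentiable (by simp)
  refine ⟨φ x, mem_image_of_mem φ hx, φ ∘ c, a, b, hab,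
    LorentzianMetric.IsFutureTimelikeCurveOn.comp_isIsometricImmersion hφd hτ hφ.2 hc, ?_, ?_⟩
  · show φ (c a) = φ x
    rw [hca]
  · show φ (c b) = φ q
    rw [hcb]

/-- **Isometric immersions of developments carry chronological pasts into chronological pasts**
(`q ∈ I⁻(S) ⇒ φ q ∈ I⁻(φ(S))`, by time duality `mem_chronologicalPast_iff_exists`).
[cite: ONeillSemiRiemannian1983, Ch. 14, p. 402] -/
theorem mem_chronologicalPast_comp
    (hφ : 𝒟₁.metric.IsIsometricImmersion 𝒟₂.metric.toPseudoRiemannianMetric φ)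
    (hτ : 𝒟₁.timeOrientation.PreservesTimeOrientation φ 𝒟₂.timeOrientation)
    {S : Set 𝒟₁.carrier} {q : 𝒟₁.carrier} (hq : q ∈ 𝒟₁.metric.chronologicalPast 𝒟₁.timeOrientation S) :
    φ q ∈ 𝒟₂.metric.chronologicalPast 𝒟₂.timeOrientation (φ '' S) := by
  obtain ⟨s, hs, hsq⟩ :=
    (LorentzianMetric.mem_chronologicalPast_iff_exists (g := 𝒟₁.metric) (τ := 𝒟₁.timeOrientation)).1 hq
  have h := mem_chronologicalFuture_comp hφ hτ hsq
  rw [image_singleton] at h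
  exact (LorentzianMetric.mem_chronologicalPast_iff_exists (g := 𝒟₂.metric) (τ := 𝒟₂.timeOrientation)).2
    ⟨φ s, mem_image_of_mem φ hs, h⟩

/-- **Isometries of developments carry end-visible events to end-visible events**: for a compact
`K ⊆ X`, the far-launched complete ray `δ` from `p ∉ K` witnessing `q ∈ I⁻(δ(s ∩ [0, ∞)))` in `𝒟₁`
goes to the complete ray `φ ∘ δ` from the same `p` in `𝒟₂` (`isNormalisedNullRayFrom_comp`), and
`φ q ∈ I⁻((φ ∘ δ)(s ∩ [0, ∞)))` (`mem_chronologicalPast_comp`). [cite: HawkingEllis1973, §9.2] -/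
theorem IsEndVisibleEvent.comp [𝒟₁.metric.HasLeviCivita] [𝒟₂.metric.HasLeviCivita]
    (hφ : 𝒟₁.metric.IsIsometricImmersion 𝒟₂.metric.toPseudoRiemannianMetric φ)
    (hφ' : 𝒟₂.metric.IsIsometricImmersion 𝒟₁.metric.toPseudoRiemannianMetric φ')
    (hleft : LeftInverse φ' φ)
    (hτ : 𝒟₁.timeOrientation.PreservesTimeOrientation φ 𝒟₂.timeOrientation)
    (hι : φ ∘ 𝒟₁.embed = 𝒟₂.embed) {q : 𝒟₁.carrier} (hq : IsEndVisibleEvent 𝒟₁ q) :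
    IsEndVisibleEvent 𝒟₂ (φ q) := by
  intro K hK
  obtain ⟨p, hp, δ, s, hδ, hs, hqδ⟩ := hq K hK
  refine ⟨p, hp, φ ∘ δ, s, isNormalisedNullRayFrom_comp hφ hφ' hleft hτ hι hδ, hs, ?_⟩
  rw [image_comp]
  exact mem_chronologicalPast_comp hφ hτ hqδ

/-- The end-visible region goes into the end-visible region. [cite: HawkingEllis1973, §9.2] -/
theorem image_endVisibleRegion_subset [𝒟₁.metric.HasLeviCivita] [𝒟₂.metric.HasLeviCivita]
    (hφ : 𝒟₁.metric.IsIsometricImmersion 𝒟₂.metric.toPseudoRiemannianMetric φ)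
    (hφ' : 𝒟₂.metric.IsIsometricImmersion 𝒟₁.metric.toPseudoRiemannianMetric φ')
    (hleft : LeftInverse φ' φ)
    (hτ : 𝒟₁.timeOrientation.PreservesTimeOrientation φ 𝒟₂.timeOrientation)
    (hι : φ ∘ 𝒟₁.embed = 𝒟₂.embed) :
    φ '' endVisibleRegion 𝒟₁ ⊆ endVisibleRegion 𝒟₂ := by
  rintro _ ⟨q, hq, rfl⟩
  exact IsEndVisibleEvent.comp hφ hφ' hleft hτ hι hq

end Transport

/-! ## §2. The inverse package of an isometry of developments -/

/-- **The inverse of an isometry of developments is an isometry of developments** — the data of §1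
for `ψ.symm`: `ψ⁻¹` is an isometric immersion (`(ψ⁻¹)^* g₁ = (ψ⁻¹)^* ψ^* g₂ = g₂`), preserves the time
orientation (`dψ (dψ⁻¹ T₂) = T₂` is future-directed and `dψ` reflects future-directedness,
`PreservesTimeOrientation.isFutureDirected_of_mfderiv`) and satisfies `ψ⁻¹ ∘ ι₂ = ι₁`. As in
`DataEmbedding.IsIsometricTo.symm`. [cite: Sbierski2016AHP, §2, Remark (1) after the definition of a CGHD] -/
theorem symm_package (ψ : Diffeomorph (𝓡 (3 + 1)) (𝓡 (3 + 1)) 𝒟₁.carrier 𝒟₂.carrier ∞)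
    (hiso : 𝒟₁.metric.IsIsometry 𝒟₂.metric.toPseudoRiemannianMetric ψ)
    (hτ : 𝒟₁.timeOrientation.PreservesTimeOrientation ψ 𝒟₂.timeOrientation)
    (hι : (ψ : 𝒟₁.carrier → 𝒟₂.carrier) ∘ 𝒟₁.embed = 𝒟₂.embed) :
    𝒟₂.metric.IsIsometricImmersion 𝒟₁.metric.toPseudoRiemannianMetric ψ.symm ∧
      𝒟₂.timeOrientation.PreservesTimeOrientation ψ.symm 𝒟₁.timeOrientation ∧
        (ψ.symm : 𝒟₂.carrier → 𝒟₁.carrier) ∘ 𝒟₂.embed = 𝒟₁.embed := by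
  -- adapted from `DataEmbedding.IsIsometricTo.symm` (CauchyDevelopmentIsometryClasses)
  have hψd : MDifferentiable (𝓡 (3 + 1)) (𝓡 (3 + 1)) ψ := ψ.contMDiff.mdifferentiable (by simp)
  have hψsd : MDifferentiable (𝓡 (3 + 1)) (𝓡 (3 + 1)) ψ.symm := ψ.symm.contMDiff.mdifferentiable (by simp)
  have hid : (ψ : 𝒟₁.carrier → 𝒟₂.carrier) ∘ ψ.symm = id := funext ψ.apply_symm_apply
  have hiso' : ∀ z, pullbackBilin (I := 𝓡 (3 + 1)) (I' := 𝓡 (3 + 1)) ψ.symm 𝒟₁.metric.val z =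
      𝒟₂.metric.val z := by
    intro z
    have h1 : 𝒟₁.metric.val = pullbackBilin (I := 𝓡 (3 + 1)) (I' := 𝓡 (3 + 1)) ψ 𝒟₂.metric.val :=
      (funext hiso).symm
    rw [h1, ← pullbackBilin_comp hψd hψsd, hid, pullbackBilin_id]
  have hkey : ∀ (z : 𝒟₂.carrier) (w : TangentSpace (𝓡 (3 + 1)) z),
      mfderiv (𝓡 (3 + 1)) (𝓡 (3 + 1)) ψ (ψ.symm z) (mfderiv (𝓡 (3 + 1)) (𝓡 (3 + 1)) ψ.symm z w) = w := by
    intro z w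
    have h := mfderiv_comp z (hψd (ψ.symm z)) (hψsd z)
    rw [hid, mfderiv_id] at h
    exact (congrArg (fun L ↦ L w) h).symm
  refine ⟨⟨ψ.symm.contMDiff, hiso'⟩, fun z ↦ ?_, ?_⟩
  · refine hτ.isFutureDirected_of_mfderiv hiso ?_
    rw [hkey, ψ.apply_symm_apply]
    exact 𝒟₂.timeOrientation.isFutureDirected_vectorField z
  · rw [← hι]
    funext x
    simp

/-! ## §3. NoHidden per development descends to isometry classes -/

/-- **`CompleteRaysNearEndVisible` is transported along isometries of developments**: if every point
`γ t`, `t ≥ 0`, of every future-complete normalised null ray of `𝒟₁` lies in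
`closure (endVisibleRegion 𝒟₁)` and `𝒟₁` is isometric to `𝒟₂` as a development, the same holds for
`𝒟₂`. A complete ray `γ` of `𝒟₂` pulls back to the complete ray `ψ⁻¹ ∘ γ` of `𝒟₁` (§1 for the inverse
package, `symm_package`), whose points lie in `closure (endVisibleRegion 𝒟₁)`; push forward with the
homeomorphism `ψ` (`image_closure_subset_closure_image`) and `ψ(endVisibleRegion 𝒟₁) ⊆
endVisibleRegion 𝒟₂` (§1 for `ψ`). [cite: Sbierski2016AHP, §2, Remark (1) after the definition of a CGHD] -/
theorem completeRaysNearEndVisible_of_isIsometricTo (h : 𝒟₁.IsIsometricTo 𝒟₂)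
    (h₁ : CompleteRaysNearEndVisible 𝒟₁) : CompleteRaysNearEndVisible 𝒟₂ := by
  intro inst₂ p γ dom hγ hdom t ht ht0
  haveI : 𝒟₂.metric.HasLeviCivita := inst₂
  haveI : 𝒟₁.metric.HasLeviCivita := PseudoRiemannianMetric.hasLeviCivita _
  obtain ⟨ψ, hiso, hτ, hι⟩ := h
  obtain ⟨hφ', hτ', hι'⟩ := symm_package ψ hiso hτ hι
  have hφ : 𝒟₁.metric.IsIsometricImmersion 𝒟₂.metric.toPseudoRiemannianMetric ψ := ⟨ψ.contMDiff, hiso⟩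
  -- pull the ray back to `𝒟₁`
  have hγ₁ : 𝒟₁.metric.IsNormalisedNullRayFrom 𝒟₁.timeOrientation 𝒟₁.embed 𝒟₁.normal p
      (ψ.symm ∘ γ) dom :=
    isNormalisedNullRayFrom_comp hφ' hφ ψ.apply_symm_apply hτ' hι' hγ
  have hcl₁ : (ψ.symm ∘ γ) t ∈ closure (endVisibleRegion 𝒟₁) := h₁ p (ψ.symm ∘ γ) dom hγ₁ hdom t ht ht0
  -- push forward with `ψ`
  have hγt : γ t = ψ ((ψ.symm ∘ γ) t) := (ψ.apply_symm_apply (γ t)).symm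
  rw [hγt]
  refine closure_mono (image_endVisibleRegion_subset hφ hφ' ψ.symm_apply_apply hτ hι) ?_
  exact image_closure_subset_closure_image ψ.continuous (mem_image_of_mem ψ hcl₁)

/-- **NoHidden per development is an invariant of the isometry class of a Cauchy development.**
[cite: Sbierski2016AHP, §2, Remark (1) after the definition of a CGHD] -/
theorem completeRaysNearEndVisible_iff_of_isIsometricTo (h : 𝒟₁.IsIsometricTo 𝒟₂) :
    CompleteRaysNearEndVisible 𝒟₁ ↔ CompleteRaysNearEndVisible 𝒟₂ :=
  ⟨completeRaysNearEndVisible_of_isIsometricTo h, completeRaysNearEndVisible_of_isIsometricTo h.symm⟩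

/-! ## §4. The stub on the whole fibre over the trivial datum -/

/-- **NoHIDDEN HOLDS AT EVERY MAXIMAL VACUUM CAUCHY DEVELOPMENT OF THE TRIVIAL DATUM**, unconditionally:
such a development is isometric, as a development, to Minkowski space
(`Minkowski.isIsometricTo_vacuumCauchyDevelopment_of_isMaximal`: Minkowski space is geodesically
complete, so its embedding into the maximal development is onto), NoHidden per development holds for
Minkowski space (`MinkowskiModel.minkowski_completeRaysNearEndVisible`), and NoHidden descends to
isometry classes (`completeRaysNearEndVisible_of_isIsometricTo`). [cite: Ringstrom2009, Thm. 16.6] -/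
theorem completeRaysNearEndVisible_of_isMaximal_trivialData (𝒟 : VacuumCauchyDevelopment trivialData)
    (hmax : 𝒟.IsMaximal) : CompleteRaysNearEndVisible 𝒟.toCauchyDevelopment :=
  completeRaysNearEndVisible_of_isIsometricTo (Minkowski.isIsometricTo_vacuumCauchyDevelopment_of_isMaximal hmax)
    ChannelsResolveTameDevelopmentsR.MinkowskiModel.minkowski_completeRaysNearEndVisible

/-- **THE REGISTERED STUB `stub_noHiddenCompleteRays` OF LINE `Sketch` HOLDS ON THE FIBRE
`(X, D) = (ℝ³, (δ, 0))`** — its body with `X = Minkowski.slice`, `D = trivialData` is a theorem for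
EVERY maximal development `𝒟` (complete `𝓘⁺`, (i), (ii) idle; `IsMaximal` used, to identify `𝒟` with
Minkowski space up to isometry). So a refutation of the stub needs an admissible datum other than the
trivial one; on paper a second end or non-trivial topology of `Σ` (the hidden-bag mechanism).
[cite: DafermosLuk2017, Conjecture 1] -/
theorem stub_noHiddenCompleteRays_trivialData : ∀ 𝒟 : VacuumCauchyDevelopment trivialData, 𝒟.IsMaximal → _root_.Summit.FinalStateConjecture.HasCompleteNullInfinity 𝒟.toCauchyDevelopment → (TrappedSet.NoExtremalRemnant 𝒟 ∧ TrappedSet.TameOuterRegion 𝒟) → CompleteRaysNearEndVisible 𝒟.toCauchyDevelopment :=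
  fun 𝒟 hmax _ _ ↦ completeRaysNearEndVisible_of_isMaximal_trivialData 𝒟 hmax

end Summit.FinalStateConjecture.FinalStateConjecture.Theorems.EndVisible

end
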